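import Summits.Ventures.HSemireg.GeneralStructureTrackW
import Literature.AlgebraicGeometry.HodgeTheory.SemiregularVariationalHodgeISemiregularModel
import HarnessLib

/-!
# Venture HSemireg — the SHEAF door in ONE-MODEL form: an `I`-semiregular vector bundle ON THE ANCHOR `P.X` itself
# (no `∀ X₀ ≅ P.X` quantifier, no transport of `IsISemiregular` along scheme isomorphisms)

HONEST FRAMING. Lean index of the computation cell `pub-hsemireg`; nothing about any explicit variety is asserted, every
published input is a hypothesis BY NAME, nothing here says HC / HC_CM / HC_AV is proved. Sections 1–3 are the literature
seat's (lit-1, g4) kernel-checked draft, proposed by theory seat 2 on the lead's ruling R-41(e); §4 adds the hyperbolic-anchor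
predicate and the door theorems of `GeneralStructureTrackW.lean` §2 / `TenfoldDoor.lean` with the every-model sheaf seed
replaced by the one-model one (`lit/LEAN-MAP-Bloch1972-BF2003.md` ADDENDUM 3; `LEAN-SIDE.md` §2).

`SheafSeed.lean`'s `HasBFSheafSeedAt C n I P h w` asks for the seed on EVERY model `e : P.X ≅ X₀`, because the refereed
fact it consumes, `BuchweitzFlenner2003_variationalHodge_ISemiregular`, wants `ℰ₀` on the CHOSEN fibre
`fiberOver f s₀` of the reach family; a census row certifies ONE object on ONE model, and the tree cannot transport
`IsISemiregular` along `e` (referee REVIEW-LEAN-SPINE-1 §3(c); `LEAN-SIDE.md` §2 «MODEL TRANSPORT»). The Literature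
rendering `BuchweitzFlenner2003_variationalHodge_ISemiregular_model` (BF Thm. 5.1 with the model isomorphism
`e : X₀ ≅ fiberOver π s₀` IN ITS BINDERS — the shape of Bloch's `BlochSemiregularSpreadOfSubscheme`; the fixed-fibre
fact is its proved corollary) removes the need: this file restates the door with the seed ON `P.X`.

* `HasBFSheafSeedOn C n I P h w` (PREDICATE): a finite locally free `ℰ₀` on `P.X`, `q ∈ ℚ`, `c : ℕ → ℚ`, with `n ∈ I`,
  `ℰ₀` `I`-semiregular (`IsISemiregular hℰ₀ {q' | q' + 1 ∈ I}`), `ch_n(ℰ₀) = q·hⁿ + w`, `ch_p(ℰ₀) = c_p·hᵖ`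
  (`p ∈ I`, `p ≠ n`) — ONE object on ONE model, exactly what a census row certifies.
* `hasBFSheafSeedOn_of_hasBFSheafSeedAt` (PROVED): the every-model seed gives the one-model seed (`X₀ := P.X`,
  `e := Iso.refl`).
* `weilAnchorLocalClause_of_BFmodel_of_sheafSeedOn` (PROVED):
  **`BuchweitzFlenner2003_variationalHodge_ISemiregular_model ∧ HasBFSheafSeedOn C n I P h w ⟹ WeilAnchorLocalClause n d P h w`**,
  the proof of `weilAnchorLocalClause_of_BF_of_sheafSeedAt` verbatim with the fact applied at `(X₀ := P.X, e := e₀)`.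
* `hasLocallyAlgebraicWeilAnchor_of_BFmodel_of_sheafSeedOn` (PROVED): the hyperbolic-anchor currency
  `HasLocallyAlgebraicWeilAnchor N d` from ONE one-model seed on a split anchor (unbundled binders).
* §4 `HasHyperbolicBFSheafSeedOn C N d I` (PREDICATE) := the binders of `GeneralStructure.HasHyperbolicBFSheafSeed C N d I`
  verbatim with `HasBFSheafSeedAt` replaced by `HasBFSheafSeedOn`; `hasHyperbolicBFSheafSeedOn_of_hasHyperbolicBFSheafSeed`
  (every-model ⟹ one-model); and the doors with the predicate swapped and BF 5.1 in its model rendering: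
  `hasLocallyAlgebraicWeilAnchor_of_BFmodel_of_hyperbolicBFSheafSeedOn`, `splitHyperplane_of_reach_of_BFmodel_of_sheafSeedOn`,
  `weilAlgebraicAll_of_sheafSeedOn_lt` (`2 ≤ n < N`, same `d`), `weilAlgebraicAll_below_of_reach_of_BFmodel_of_sheafSeedsOn`,
  `weilClassesImaginaryQuadratic_of_reach_of_BFmodel_of_cofinalSheafSeedsOn`, and the DOOR #2 instance
  `weilAlgebraicAll_discOne_of_sheafSeedOn_five` (`N = 5`, `d = 1` ⟹ `WeilAlgebraicAll 4 1 ∧ 3 1 ∧ 2 1`). RESULT: the sheaf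
  door of record takes ONE object on ONE model with 0 transport obligations, like the lci doors; CAVEAT C1 (finite locally
  free `ℰ₀` only) is unchanged.

References: [BuchweitzFlenner2003] §5 Thm. 5.1, §5 (I-semiregular), §6 Ex. 6.2, 7.18; [Deligne1982HodgeCycles] proof of
Thm. 4.8; [VoisinHodgeI2002] §9.2.1, Thm. 9.3; [Schoen1998HodgeWeilAddendum] §10; [Weil1977HodgeRing] §3;
[Markman2025SecantWeil] §1.5 (preprint).
-/

noncomputable section

open CategoryTheory AlgebraicGeometry
open _root_.Topology _root_.Filter

namespace Summit.Ventures.HSemireg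

open Literature.AlgebraicGeometry Literature.AlgebraicGeometry.Motives
open Literature.AlgebraicGeometry.HodgeTheory
open Literature.AlgebraicTopology.SingularHomology
open Summit.HodgeConjecture.HodgeConjecture.WeilTypeLadder

/-! ## The one-model sheaf seed -/

/-- **A Buchweitz–Flenner sheaf seed for `q·hⁿ + w` ON the abelian variety `P`** (PREDICATE, nothing asserted; a DESIGN
input): a finite locally free `ℰ₀` on `P.X`, `q ∈ ℚ` and `c : ℕ → ℚ` with `n ∈ I`, `ℰ₀` `I`-semiregular
(`IsISemiregular hℰ₀ {q' | q' + 1 ∈ I}`, BF's `σ_I` in the tree's form-degree numbering), `ch_n(ℰ₀) = q·hⁿ + w` and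
`ch_p(ℰ₀) = c_p·hᵖ` for `p ∈ I`, `p ≠ n`. One object on one model (cf. `HasBFSheafSeedAt`: the same on every model
`e : P.X ≅ X₀`). [cite: BuchweitzFlenner2003, §5 Thm. 5.1 (hypotheses) and §5 (I-semiregular)]
[cite: Markman2025SecantWeil, §1.5] -/
def HasBFSheafSeedOn (C : ChernCharacterBetti) (n : ℕ) (I : Finset ℕ) (P : AbelianVariety ℂ)
    (h : complexBetti P.X 2) (w : complexBetti P.X (2 * n)) : Prop :=
  ∃ (E₀ : P.X.left.Modules) (hE₀ : IsFiniteLocallyFree E₀) (q : ℚ) (c : ℕ → ℚ),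
    n ∈ I ∧ IsISemiregular hE₀ {q' | q' + 1 ∈ I} ∧
    C.ch P.X E₀ n = ((q : ℚ) : ℂ) • cupPowTwo h n + w ∧
    ∀ p ∈ I, p ≠ n → C.ch P.X E₀ p = ((c p : ℚ) : ℂ) • cupPowTwo h p

/-- The every-model seed gives the one-model seed (take the model `X₀ := P.X`, `e := Iso.refl`).
[cite: BuchweitzFlenner2003, §5 (I-semiregular)] -/
theorem hasBFSheafSeedOn_of_hasBFSheafSeedAt {C : ChernCharacterBetti} {n : ℕ} {I : Finset ℕ}
    {P : AbelianVariety ℂ} {h : complexBetti P.X 2} {w : complexBetti P.X (2 * n)}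
    (hS : HasBFSheafSeedAt C n I P h w) : HasBFSheafSeedOn C n I P h w := by
  obtain ⟨E₀, hE₀, q, c, hnI, hsr, hchn, hchp⟩ := hS P.X (Iso.refl _)
  refine ⟨E₀, hE₀, q, c, hnI, hsr, ?_, fun p hp hpn ↦ ?_⟩
  · have h' := hchn
    simp only [Iso.refl_hom, complexBetti.map_id] at h'
    exact h'
  · have h' := hchp p hp hpn
    simp only [Iso.refl_hom, complexBetti.map_id] at h'
    exact h'

/-! ## BF Thm. 5.1 (model rendering) ∧ one one-model seed ⟹ the local clause at the anchor -/

/-- **The local variational clause from ONE `I`-semiregular vector bundle ON the anchor.** Granting the model rendering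
`BuchweitzFlenner2003_variationalHodge_ISemiregular_model` of BF Thm. 5.1, a one-model sheaf seed for `q·hⁿ + w` on `P`
gives `WeilAnchorLocalClause n d P h w` for every `d`. Proof: as `weilAnchorLocalClause_of_BF_of_sheafSeedAt`, with the
fact applied at the model `e₀ : P.X ≅ 𝒳_{s₀}` supplied by the clause, the classes `(e₀⁻¹)^* ch_p(ℰ₀)` being the
restrictions `(q·Hⁿ + W)|_{s₀}`, `c_p·Hᵖ|_{s₀}` (`e₀^*` is injective and `e₀^*(e₀⁻¹)^* = id`).
[cite: BuchweitzFlenner2003, §5 Thm. 5.1] [cite: VoisinHodgeI2002, §9.2.1 and Thm. 9.3] -/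
theorem weilAnchorLocalClause_of_BFmodel_of_sheafSeedOn {n : ℕ} (d : ℕ) (C : ChernCharacterBetti) {I : Finset ℕ}
    (hBF : BuchweitzFlenner2003_variationalHodge_ISemiregular_model) {P : AbelianVariety ℂ} {h : complexBetti P.X 2}
    {w : complexBetti P.X (2 * n)} (hS : HasBFSheafSeedOn C n I P h w) : WeilAnchorLocalClause n d P h w := by
  intro 𝒳 S f hf _ hSqp hSirr hsm _ H W hH hW s₀ e₀ hH₀ hW₀
  -- (1) `Rⁱf_*ℂ` is a local system on all of `S(ℂ)`, a path connected, locally path connected manifold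
  haveI := hSirr
  haveI := hsm
  haveI : LocallyOfFiniteType S.hom := hSqp.locallyOfFiniteType
  haveI : ConnectedSpace (ComplexPoints S) := (ComplexPoints.connectedSpace_iff_holds S).2 inferInstance
  obtain ⟨dS, hd⟩ := exists_smoothOfRelativeDimension_of_connectedSpace_complexPoints S
  haveI := hd
  haveI := pathConnectedSpace_complexPoints_of_smoothOfRelativeDimension S dS
  have hU : IsCohomologicallyLocallyTrivialOn f (Set.univ : Set (ComplexPoints S)) :=
    isCohomologicallyLocallyTrivialOn_univ_of_isSmoothProjectiveFamily f dS hf hSqp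
  letI := ComplexPoints.chartedSpace S dS
  haveI : LocallyPathConnectedSpace (ComplexPoints S) :=
    ChartedSpace.locallyPathConnectedSpace (EuclideanSpace ℝ (Fin (2 * dS))) (ComplexPoints S)
  let s₀' : (Set.univ : Set (ComplexPoints S)) := ⟨s₀, Set.mem_univ s₀⟩
  -- (2) the one-model seed on `P.X`
  obtain ⟨E₀, hE₀, q, c, hnI, hsr, hchn, hchp⟩ := hS
  -- the global class `B := q·Hⁿ + W` and its fibre restrictions
  set Bcl : complexBetti 𝒳 (2 * n) := ((q : ℚ) : ℂ) • cupPowTwo H n + W with hBdef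
  have hres : ∀ s : ComplexPoints S, complexBetti.map (fiberι f s) (2 * n) Bcl =
      ((q : ℚ) : ℂ) • cupPowTwo (complexBetti.map (fiberι f s) 2 H) n + complexBetti.map (fiberι f s) (2 * n) W := by
    intro s
    rw [hBdef, map_add, map_smul, complexBetti_map_cupPowTwo']
  have hBrat : ∀ s : ComplexPoints S,
      IsOfHodgeType (2 * n) (fiberOver f s) (2 * n) n n (complexBetti.map (fiberι f s) (2 * n) Bcl) := by
    intro s
    rw [hres]
    exact ((isOfHodgeType_cupPowTwo (hf.isSmoothProjective s) (hH s).2 n).smul _).add (hf.isSmoothProjective s) (hW s).2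
  have hHp₀ : ∀ p : ℕ, complexBetti.map e₀.hom (2 * p) (complexBetti.map (fiberι f s₀) (2 * p) (cupPowTwo H p)) =
      cupPowTwo h p := by
    intro p
    rw [complexBetti_map_cupPowTwo', complexBetti_map_cupPowTwo', hH₀]
  -- `(e₀⁻¹)^* ch_n(ℰ₀) = B|_{s₀}` and `(e₀⁻¹)^* ch_p(ℰ₀) = c_p·Hᵖ|_{s₀}` (compare after pulling back by the iso `e₀`)
  have hchn' : complexBetti.map e₀.inv (2 * n) (C.ch P.X E₀ n) = complexBetti.map (fiberι f s₀) (2 * n) Bcl := by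
    apply complexBetti.map_injective_of_iso e₀ (2 * n)
    rw [BuchweitzFlenner2003_variationalHodge_ISemiregular_model.map_hom_map_inv, hchn, hres, map_add, map_smul,
      complexBetti_map_cupPowTwo', hH₀, hW₀]
  have hchp' : ∀ p ∈ I, p ≠ n → complexBetti.map e₀.inv (2 * p) (C.ch P.X E₀ p) =
      complexBetti.map (fiberι f s₀) (2 * p) (((c p : ℚ) : ℂ) • cupPowTwo H p) := by
    intro p hp hpn
    apply complexBetti.map_injective_of_iso e₀ (2 * p)
    rw [BuchweitzFlenner2003_variationalHodge_ISemiregular_model.map_hom_map_inv, hchp p hp hpn, map_smul, map_smul,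
      hHp₀ p]
  -- (3) the hypotheses of Thm. 5.1 over `U = S(ℂ)`: all transports of `(e₀⁻¹)^* ch_p(ℰ₀)`, `p ∈ I`, are of type `(p,p)`
  have hHodge : ∀ p ∈ I, ∀ (t : (Set.univ : Set (ComplexPoints S))) (γ : Path.Homotopic.Quotient s₀' t),
      IsOfHodgeType (2 * n) (fiberOver f t.1) (2 * p) p p
        (transportFun f (2 * p) hU γ (complexBetti.map e₀.inv (2 * p) (C.ch P.X E₀ p))) := by
    intro p hp t γ
    by_cases hpn : p = n
    · subst hpn
      rw [hchn', transportFun_map_fiberι f (2 * p) hU γ Bcl]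
      exact hBrat t.1
    · rw [hchp' p hp hpn, transportFun_map_fiberι f (2 * p) hU γ, map_smul, complexBetti_map_cupPowTwo']
      exact (isOfHodgeType_cupPowTwo (hf.isSmoothProjective t.1) (hH t.1).2 p).smul _
  obtain ⟨W', hWo, hW'₀, hWU, hW'⟩ := hBF C f (2 * n) hf hsm hU s₀' P.X e₀ E₀ hE₀ I hsr hHodge
  -- (4) conclude on the path component of `s₀` in `W'`
  refine ⟨pathComponentIn W' s₀, q, hWo.pathComponentIn s₀, mem_pathComponentIn_self hW'₀, fun t ht ↦ ?_⟩
  have hj : JoinedIn W' s₀ t := ht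
  have hpm : ∀ u, hj.somePath u ∈ W' := hj.somePath_mem
  let γ : Path (⟨s₀, hW'₀⟩ : W') ⟨t, pathComponentIn_subset ht⟩ :=
    { toFun := fun u ↦ ⟨hj.somePath u, hpm u⟩
      continuous_toFun := hj.somePath.continuous.subtype_mk _
      source' := Subtype.ext hj.somePath.source
      target' := Subtype.ext hj.somePath.target }
  have hmem := hW' n hnI ⟨t, pathComponentIn_subset ht⟩ ⟦γ⟧
  have htr : transportFun f (2 * n) (hU.mono hWU hWo) ⟦γ⟧ (complexBetti.map e₀.inv (2 * n) (C.ch P.X E₀ n)) =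
      complexBetti.map (fiberι f t) (2 * n) Bcl := by
    rw [hchn']
    exact transportFun_map_fiberι f (2 * n) (hU.mono hWU hWo) ⟦γ⟧ Bcl
  change transportFun f (2 * n) (hU.mono hWU hWo) ⟦γ⟧ (complexBetti.map e₀.inv (2 * n) (C.ch P.X E₀ n)) ∈ _ at hmem
  rw [htr, hres] at hmem
  exact hmem

/-! ## The hyperbolic-anchor currency from ONE one-model seed -/

/-- **`HasLocallyAlgebraicWeilAnchor N d` from a one-model sheaf seed on a split anchor** (the input of
`TenfoldDoor.weilAlgebraicAll_of_localAnchor_lt` / `Leverage.weilAlgebraicAll_of_localAnchor_succ`): a complex abelian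
`2N`-fold `P` with `ψ₀² = -d`, a projective embedding `e` and rational `a ≠ 0` with `(P, ψ₀)` of hyperbolic Weil type for
`h_K = d·e^*a + ψ₀^*e^*a`, a non-zero rational Weil class `w`, and `HasBFSheafSeedOn C N I P h_K w`.
[cite: BuchweitzFlenner2003, §5 Thm. 5.1] [cite: Deligne1982HodgeCycles, proof of Thm. 4.8] -/
theorem hasLocallyAlgebraicWeilAnchor_of_BFmodel_of_sheafSeedOn {C : ChernCharacterBetti} {N d : ℕ} {I : Finset ℕ}
    (hBF : BuchweitzFlenner2003_variationalHodge_ISemiregular_model)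
    (P : AbelianVariety ℂ) (ψ₀ : P ⟶ P) (e : ProjectiveEmbedding P.X) (a : complexBetti (projectiveSpace e.n ℂ) 2)
    (w : complexBetti P.X (2 * N)) (hP : P.dim = 2 * N) (hψ : ψ₀ ≫ ψ₀ = -(d • 𝟙 P)) (ha : IsRationalClass a)
    (ha0 : a ≠ 0)
    (hhyp : IsHyperbolicWeilType P ψ₀ N
      ((d : ℂ) • complexBetti.map e.ι 2 a + complexBetti.map ψ₀.hom.hom.hom 2 (complexBetti.map e.ι 2 a)))
    (hwW : w ∈ weilClassesOf P ψ₀ N d) (hwr : IsRationalClass w) (hw0 : w ≠ 0)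
    (hS : HasBFSheafSeedOn C N I P
      ((d : ℂ) • complexBetti.map e.ι 2 a + complexBetti.map ψ₀.hom.hom.hom 2 (complexBetti.map e.ι 2 a)) w) :
    HasLocallyAlgebraicWeilAnchor N d :=
  (hasLocallyAlgebraicWeilAnchor_iff N d).2
    ⟨P, ψ₀, e, a, w, hP, hψ, ha, ha0, hhyp, hwW, hwr, hw0, weilAnchorLocalClause_of_BFmodel_of_sheafSeedOn d C hBF hS⟩

/-! ## §4 The hyperbolic one-model sheaf seed and the doors with the predicate swapped -/

section Hyperbolic

open Summit.HodgeConjecture.HodgeConjecture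
open Summit.HodgeConjecture.HodgeConjecture.Cruxes.HodgeAbelianVarieties.EStepSecantInduction
open Summit.Ventures.HSemireg.GeneralStructure

/-- **`HasHyperbolicBFSheafSeedOn C N d I` — a hyperbolic Buchweitz–Flenner sheaf seed at level `N` for `K = ℚ(√-d)`, ONE
object on ONE model** (PREDICATE, nothing asserted; the cell's SHEAF-side census rows are its intended witnesses): a complex
abelian `2N`-fold `P` with `ψ₀ ≫ ψ₀ = -(d • 𝟙 P)`, a projective embedding `e` and a rational `a ≠ 0` with `(P, ψ₀)` of
HYPERBOLIC (split) Weil type for `h_K = d·e^*a + ψ₀^*e^*a`, a non-zero rational class `w` of the Weil plane, and the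
one-model seed `HasBFSheafSeedOn C N I P h_K w` (an `I`-semiregular FINITE LOCALLY FREE `ℰ₀` ON `P.X`, `N ∈ I`,
`ch_N(ℰ₀) = q·h_Kᴺ + w`, `ch_p(ℰ₀) = c_p·h_Kᵖ` for `p ∈ I`, `p ≠ N`). Verbatim the binders of
`GeneralStructure.HasHyperbolicBFSheafSeed C N d I` with `HasBFSheafSeedAt` replaced by `HasBFSheafSeedOn`. CAVEAT C1:
finite locally free only (BF Thm. 5.1 as rendered does not cover coherent sheaves or perfect complexes).
[cite: BuchweitzFlenner2003, §5 Thm. 5.1 and §5 (I-semiregular)] [cite: Markman2025SecantWeil, §1.5 (preprint, unrefereed)] -/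
def HasHyperbolicBFSheafSeedOn (C : ChernCharacterBetti) (N d : ℕ) (I : Finset ℕ) : Prop :=
  ∃ (P : AbelianVariety ℂ) (ψ₀ : P ⟶ P) (e : ProjectiveEmbedding P.X) (a : complexBetti (projectiveSpace e.n ℂ) 2)
    (w : complexBetti P.X (2 * N)),
    P.dim = 2 * N ∧ ψ₀ ≫ ψ₀ = -(d • 𝟙 P) ∧ IsRationalClass a ∧ a ≠ 0 ∧
    IsHyperbolicWeilType P ψ₀ N
      ((d : ℂ) • complexBetti.map e.ι 2 a + complexBetti.map ψ₀.hom.hom.hom 2 (complexBetti.map e.ι 2 a)) ∧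
    w ∈ weilClassesOf P ψ₀ N d ∧ IsRationalClass w ∧ w ≠ 0 ∧
    HasBFSheafSeedOn C N I P
      ((d : ℂ) • complexBetti.map e.ι 2 a + complexBetti.map ψ₀.hom.hom.hom 2 (complexBetti.map e.ι 2 a)) w

/-- The every-model hyperbolic sheaf seed gives the one-model one. [cite: BuchweitzFlenner2003, §5 (I-semiregular)] -/
theorem hasHyperbolicBFSheafSeedOn_of_hasHyperbolicBFSheafSeed {C : ChernCharacterBetti} {N d : ℕ} {I : Finset ℕ}
    (hS : HasHyperbolicBFSheafSeed C N d I) : HasHyperbolicBFSheafSeedOn C N d I := by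
  obtain ⟨P, ψ₀, e, a, w, hP, hψ, ha, ha0, hhyp, hwW, hwr, hw0, hseed⟩ := hS
  exact ⟨P, ψ₀, e, a, w, hP, hψ, ha, ha0, hhyp, hwW, hwr, hw0, hasBFSheafSeedOn_of_hasBFSheafSeedAt hseed⟩

/-- **The one-model sheaf door: `[BF 5.1, model rendering] ∧ HasHyperbolicBFSheafSeedOn C N d I ⟹ HasLocallyAlgebraicWeilAnchor N d`**
(`GeneralStructure.hasLocallyAlgebraicWeilAnchor_of_BF_of_hyperbolicBFSheafSeed` with the predicate swapped).
[cite: BuchweitzFlenner2003, §5 Thm. 5.1] [cite: Deligne1982HodgeCycles, proof of Thm. 4.8] -/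
theorem hasLocallyAlgebraicWeilAnchor_of_BFmodel_of_hyperbolicBFSheafSeedOn {C : ChernCharacterBetti} {N d : ℕ}
    {I : Finset ℕ} (hBF : BuchweitzFlenner2003_variationalHodge_ISemiregular_model)
    (hS : HasHyperbolicBFSheafSeedOn C N d I) : HasLocallyAlgebraicWeilAnchor N d := by
  obtain ⟨P, ψ₀, e, a, w, hP, hψ, ha, ha0, hhyp, hwW, hwr, hw0, hseed⟩ := hS
  exact hasLocallyAlgebraicWeilAnchor_of_BFmodel_of_sheafSeedOn hBF P ψ₀ e a w hP hψ ha ha0 hhyp hwW hwr hw0 hseed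

/-- **Door A, one-model sheaf version, at ONE level `(N, d)`**: reach ∧ BF 5.1 (model rendering) ∧ ONE hyperbolic one-model
sheaf seed ⟹ split `ℚ(√-d)`-Weil `2N`-folds algebraic (`GeneralStructure.splitHyperplane_of_reach_of_BF_of_sheafSeed` with
the predicate swapped). [cite: BuchweitzFlenner2003, §5 Thm. 5.1] [cite: Deligne1982HodgeCycles, proof of Thm. 4.8] -/
theorem splitHyperplane_of_reach_of_BFmodel_of_sheafSeedOn (hF : weilFamilyReach_hyperbolic) {C : ChernCharacterBetti}
    {N d : ℕ} {I : Finset ℕ} (hN : 1 ≤ N) (hd : 0 < d) (hBF : BuchweitzFlenner2003_variationalHodge_ISemiregular_model)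
    (hS : HasHyperbolicBFSheafSeedOn C N d I) : Stubs.WeilAlgebraicSplitHyperplane N d := by
  intro A φ e a hA hφ ha ha0 hhyp c hcW _ _
  exact weilClasses_algebraic_hyperbolic_of_localAnchor N d hN hd
    (hasLocallyAlgebraicWeilAnchor_of_BFmodel_of_hyperbolicBFSheafSeedOn hBF hS) hF A φ hA hφ e a ha ha0 hhyp hcW

/-- **Door D2 in one-model form, per `d`, read below the seed level** (`TenfoldDoor.weilAlgebraicAll_of_sheafSeed_lt` with the
predicate swapped): reach ∧ BF 5.1 (model rendering) ∧ ONE hyperbolic one-model `I`-semiregular sheaf seed at level `N` for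
`K = ℚ(√-d)` ⟹ `WeilAlgebraicAll n d` for every `2 ≤ n < N`. [cite: BuchweitzFlenner2003, §5 Thm. 5.1]
[cite: Deligne1982HodgeCycles, proof of Thm. 4.8] [cite: Schoen1998HodgeWeilAddendum, §10] -/
theorem weilAlgebraicAll_of_sheafSeedOn_lt (hF : weilFamilyReach_hyperbolic) {C : ChernCharacterBetti} {N d : ℕ}
    {I : Finset ℕ} (hBF : BuchweitzFlenner2003_variationalHodge_ISemiregular_model) (hS : HasHyperbolicBFSheafSeedOn C N d I)
    {n : ℕ} (hn : 2 ≤ n) (hnN : n < N) (hd : 0 < d) : WeilAlgebraicAll n d :=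
  weilAlgebraicAll_of_splitHyperplane_lt hn hnN hd
    (splitHyperplane_of_reach_of_BFmodel_of_sheafSeedOn hF (by omega) hd hBF hS)

/-- **ONE one-model sheaf-seed level suffices below it** (`GeneralStructure.weilAlgebraicAll_below_of_reach_of_BF_of_sheafSeeds`
with the predicate swapped): reach ∧ BF 5.1 (model rendering) ∧ one hyperbolic one-model sheaf seed per `d` at level `N` ⟹ ALL
`ℚ(√-d)`-Weil `2n`-folds, `2 ≤ n < N`. [cite: BuchweitzFlenner2003, §5 Thm. 5.1] [cite: Schoen1998HodgeWeilAddendum, §10] -/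
theorem weilAlgebraicAll_below_of_reach_of_BFmodel_of_sheafSeedsOn (hF : weilFamilyReach_hyperbolic)
    {C : ChernCharacterBetti} {N : ℕ} (hBF : BuchweitzFlenner2003_variationalHodge_ISemiregular_model)
    (hS : ∀ d : ℕ, 0 < d → ∃ I : Finset ℕ, HasHyperbolicBFSheafSeedOn C N d I) {n d : ℕ} (hn : 2 ≤ n) (hnN : n < N)
    (hd : 0 < d) : WeilAlgebraicAll n d := by
  obtain ⟨I, hI⟩ := hS d hd
  exact weilAlgebraicAll_of_sheafSeedOn_lt hF hBF hI hn hnN hd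

/-- **W1-COFINAL, one-model SHEAF seeds** (`GeneralStructure.weilClassesImaginaryQuadratic_of_reach_of_BF_of_cofinalSheafSeeds`
with the predicate swapped): reach ∧ BF 5.1 (model rendering) ∧ one hyperbolic one-model sheaf seed (some `I`) per
`(seed level, d)` ∧ seed levels cofinal ⟹ R∞. `HC_CM`-FREE; CAVEAT C1 applies. [cite: BuchweitzFlenner2003, §5 Thm. 5.1]
[cite: Deligne1982HodgeCycles, proof of Thm. 4.8] [cite: Schoen1998HodgeWeilAddendum, §10] [cite: Weil1977HodgeRing, §3] -/
theorem weilClassesImaginaryQuadratic_of_reach_of_BFmodel_of_cofinalSheafSeedsOn (hF : weilFamilyReach_hyperbolic)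
    (C : ChernCharacterBetti) (hBF : BuchweitzFlenner2003_variationalHodge_ISemiregular_model) (L : ℕ → Prop)
    (hcof : ∀ n : ℕ, 2 ≤ n → ∃ N : ℕ, n < N ∧ L N)
    (hS : ∀ N : ℕ, L N → ∀ d : ℕ, 0 < d → ∃ I : Finset ℕ, HasHyperbolicBFSheafSeedOn C N d I) :
    WeilClassesImaginaryQuadratic :=
  weilClassesImaginaryQuadratic_of_cofinal_splitHyperplane fun n hn ↦ by
    obtain ⟨N, hnN, hL⟩ := hcof n hn
    refine ⟨N, hnN, fun d hd ↦ ?_⟩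
    obtain ⟨I, hI⟩ := hS N hL d hd
    exact splitHyperplane_of_reach_of_BFmodel_of_sheafSeedOn hF (by omega) hd hBF hI

/-- **DOOR #2, one-model sheaf form (instance `N = 5`, `d = 1`)** (`TenfoldDoor.weilAlgebraicAll_discOne_of_sheafSeed_five` with
the predicate swapped): reach ∧ BF 5.1 (model rendering) ∧ ONE hyperbolic locally free `I`-semiregular sheaf seed ON a split
`ℚ(i)`-Weil abelian TENFOLD ⟹ every rational Weil class on every `ℚ(i)`-Weil abelian eightfold, sixfold and fourfold (every
discriminant, split and non-split) is algebraic. [cite: BuchweitzFlenner2003, §5 Thm. 5.1] [cite: Schoen1998HodgeWeilAddendum, §10] -/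
theorem weilAlgebraicAll_discOne_of_sheafSeedOn_five (hF : weilFamilyReach_hyperbolic) {C : ChernCharacterBetti}
    {I : Finset ℕ} (hBF : BuchweitzFlenner2003_variationalHodge_ISemiregular_model) (hS : HasHyperbolicBFSheafSeedOn C 5 1 I) :
    WeilAlgebraicAll 4 1 ∧ WeilAlgebraicAll 3 1 ∧ WeilAlgebraicAll 2 1 :=
  ⟨weilAlgebraicAll_of_sheafSeedOn_lt hF hBF hS (by norm_num) (by norm_num) one_pos,
    weilAlgebraicAll_of_sheafSeedOn_lt hF hBF hS (by norm_num) (by norm_num) one_pos,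
    weilAlgebraicAll_of_sheafSeedOn_lt hF hBF hS le_rfl (by norm_num) one_pos⟩

end Hyperbolic

/-! ## Audit: nothing is decided here

Every theorem above whose conclusion is a Weil rung (`WeilClassesImaginaryQuadratic`, `WeilAlgebraicAll n d`,
`Stubs.WeilAlgebraicSplitHyperplane N d`, `HasLocallyAlgebraicWeilAnchor N d`, `WeilAnchorLocalClause n d P h w`) has among its
hypotheses a SEED (`HasBFSheafSeedOn` / `HasHyperbolicBFSheafSeedOn` — the cell's computation targets, OPEN) together with
refereed named facts BY NAME (`weilFamilyReach_hyperbolic`, `BuchweitzFlenner2003_variationalHodge_ISemiregular_model`).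
`HC_CM` does not occur. Two new `def`s (predicates), no named fact. Axiom closures: the three standard axioms only. -/

end Summit.Ventures.HSemireg

end
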